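import Mathlib
import Summits.Ventures.DiscreteObjects.Mahler.SalemSignCertificate
import Summits.Ventures.DiscreteObjects.Mahler.CensusData10to18

/-!
# Kernel certificates for the height-1 Salem cores `c16_03`, `c18_04`, `c18_09` (venture `DiscreteObjects`, target L)

Cell `pub-namedobj`, seat `pub-namedobj-mahler` (gen 10). Framing: lottery ticket; floor = certified
bounds/negative ranges.

Third-engine (kernel) certification of census cores via `salem_certificate_of_signs` (`CensusData10to18`): the only
Salem core of degree 16, `c16_03` (`1.23631793…`), and the degree-18 Salem cores `c18_04` (`1.21972085…`) and `c18_09`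
(`1.25277593…`); the degree-18 Salem core `c18_01` is the MRW minimiser (`MRWDegree18Measure`); `c18_10, c18_14, c18_16,
`c18_20` are further Salem cores certifiable by the same template (trace polynomials by the Chebyshev recursion).
-/

namespace Summit.Ventures.DiscreteObjects.Mahler

open Polynomial

/-- `traceLift` of the trace polynomial of `c16_03` is the core `c16_03`. -/
theorem traceLift_c16_03 : traceLift (X ^ 8 - X ^ 7 - C 8 * X ^ 6 + C 7 * X ^ 5 + C 20 * X ^ 4 - C 14 * X ^ 3 - C 16 * X ^ 2 + C 7 * X + 1 : ℤ[X]) = ofCoeffs c16_03 := by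
  have hdeg : (X ^ 8 - X ^ 7 - C 8 * X ^ 6 + C 7 * X ^ 5 + C 20 * X ^ 4 - C 14 * X ^ 3 - C 16 * X ^ 2 + C 7 * X + 1 : ℤ[X]).natDegree = 8 := by compute_degree!
  have hP : ofCoeffs c16_03 = (X ^ 16 - X ^ 15 - X ^ 8 - X + 1 : ℤ[X]) := by
    unfold ofCoeffs c16_03; simp [List.zipIdx]; ring
  rw [hP, traceLift, hdeg]
  simp only [Finset.sum_range_succ, Finset.sum_range_zero, zero_add, coeff_add, coeff_sub, coeff_X_pow,
    coeff_C_mul, coeff_X, coeff_one]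
  norm_num
  ring

/-- **`1.23631793 < M(c16_03) < 1.23631794`** — a degree-16 Salem number (height-1 census core). -/
theorem c16_03_measure_enclosure :
    (123631793 / 10 ^ 8 : ℝ) < intMahlerMeasure (ofCoeffs c16_03) ∧
      intMahlerMeasure (ofCoeffs c16_03) < 123631794 / 10 ^ 8 := by
  set Q : ℤ[X] := X ^ 8 - X ^ 7 - C 8 * X ^ 6 + C 7 * X ^ 5 + C 20 * X ^ 4 - C 14 * X ^ 3 - C 16 * X ^ 2 + C 7 * X + 1 with hQdef
  have hQmonic : Q.Monic := by rw [hQdef]; monicity!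
  have hQdeg : Q.natDegree = 8 := by rw [hQdef]; compute_degree!
  have hev : ∀ y : ℝ, aeval y Q = y ^ 8 - y ^ 7 - 8 * y ^ 6 + 7 * y ^ 5 + 20 * y ^ 4 - 14 * y ^ 3 - 16 * y ^ 2 + 7 * y + 1 := by
    intro y
    rw [hQdef]
    simp only [map_add, map_sub, map_mul, map_pow, aeval_X, map_ofNat, map_one]
  set c₁ : ℝ := 123631793 / 10 ^ 8 with hc₁
  set c₂ : ℝ := 123631794 / 10 ^ 8 with hc₂
  obtain ⟨y, hya, hyb, hM1, hMM⟩ := salem_certificate_of_signs hQmonic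
    [-2, -7/4, -3/2, -1, 0, 1, 3/2, 2] (by rw [hQdeg]; rfl)
    (by simp only [List.isChain_cons_cons, List.isChain_singleton, and_true]; norm_num)
    (by intro p hp; simp only [List.mem_cons, List.mem_nil_iff, or_false] at hp
        rcases hp with rfl | rfl | rfl | rfl | rfl | rfl | rfl | rfl <;> norm_num)
    (by simp only [List.isChain_cons_cons, List.isChain_singleton, and_true, hev]; norm_num)
    (a := c₁ + c₁⁻¹) (b := c₂ + c₂⁻¹) (by rw [hc₁, hc₂]; norm_num)
    (Or.inr (by rw [hc₁]; norm_num)) (by rw [hev, hev, hc₁, hc₂]; norm_num)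
  rw [traceLift_c16_03] at hM1 hMM
  have hc1y : 2 < c₁ + c₁⁻¹ := by rw [hc₁]; norm_num
  rw [abs_of_pos (by linarith)] at hMM
  have hMpos : 0 < intMahlerMeasure (ofCoeffs c16_03) := by linarith
  constructor
  · have h : c₁ + c₁⁻¹ < intMahlerMeasure (ofCoeffs c16_03) + (intMahlerMeasure (ofCoeffs c16_03))⁻¹ := by
      rw [hMM]; linarith
    exact lt_of_add_inv_lt_add_inv hM1.le (by rw [hc₁]; norm_num) h
  · have h : intMahlerMeasure (ofCoeffs c16_03) + (intMahlerMeasure (ofCoeffs c16_03))⁻¹ < c₂ + c₂⁻¹ := by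
      rw [hMM]; linarith
    exact lt_of_add_inv_lt_add_inv (by rw [hc₂]; norm_num) hMpos h

/-- `traceLift` of the trace polynomial of `c18_04` is the core `c18_04`. -/
theorem traceLift_c18_04 : traceLift (X ^ 9 - X ^ 8 - C 9 * X ^ 7 + C 8 * X ^ 6 + C 27 * X ^ 5 - C 20 * X ^ 4 - C 30 * X ^ 3 + C 16 * X ^ 2 + C 8 * X - 1 : ℤ[X]) = ofCoeffs c18_04 := by
  have hdeg : (X ^ 9 - X ^ 8 - C 9 * X ^ 7 + C 8 * X ^ 6 + C 27 * X ^ 5 - C 20 * X ^ 4 - C 30 * X ^ 3 + C 16 * X ^ 2 + C 8 * X - 1 : ℤ[X]).natDegree = 9 := by compute_degree!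
  have hP : ofCoeffs c18_04 = (X ^ 18 - X ^ 17 - X ^ 10 + X ^ 9 - X ^ 8 - X + 1 : ℤ[X]) := by
    unfold ofCoeffs c18_04; simp [List.zipIdx]; ring
  rw [hP, traceLift, hdeg]
  simp only [Finset.sum_range_succ, Finset.sum_range_zero, zero_add, coeff_add, coeff_sub, coeff_X_pow,
    coeff_C_mul, coeff_X, coeff_one]
  norm_num
  ring

/-- **`1.21972085 < M(c18_04) < 1.21972086`** — a degree-18 Salem number (height-1 census core). -/
theorem c18_04_measure_enclosure :
    (121972085 / 10 ^ 8 : ℝ) < intMahlerMeasure (ofCoeffs c18_04) ∧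
      intMahlerMeasure (ofCoeffs c18_04) < 121972086 / 10 ^ 8 := by
  set Q : ℤ[X] := X ^ 9 - X ^ 8 - C 9 * X ^ 7 + C 8 * X ^ 6 + C 27 * X ^ 5 - C 20 * X ^ 4 - C 30 * X ^ 3 + C 16 * X ^ 2 + C 8 * X - 1 with hQdef
  have hQmonic : Q.Monic := by rw [hQdef]; monicity!
  have hQdeg : Q.natDegree = 9 := by rw [hQdef]; compute_degree!
  have hev : ∀ y : ℝ, aeval y Q = y ^ 9 - y ^ 8 - 9 * y ^ 7 + 8 * y ^ 6 + 27 * y ^ 5 - 20 * y ^ 4 - 30 * y ^ 3 + 16 * y ^ 2 + 8 * y - 1 := by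
    intro y
    rw [hQdef]
    simp only [map_add, map_sub, map_mul, map_pow, aeval_X, map_ofNat, map_one]
  set c₁ : ℝ := 121972085 / 10 ^ 8 with hc₁
  set c₂ : ℝ := 121972086 / 10 ^ 8 with hc₂
  obtain ⟨y, hya, hyb, hM1, hMM⟩ := salem_certificate_of_signs hQmonic
    [-2, -7/4, -3/2, -1, 0, 1/2, 1, 7/4, 2] (by rw [hQdeg]; rfl)
    (by simp only [List.isChain_cons_cons, List.isChain_singleton, and_true]; norm_num)
    (by intro p hp; simp only [List.mem_cons, List.mem_nil_iff, or_false] at hp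
        rcases hp with rfl | rfl | rfl | rfl | rfl | rfl | rfl | rfl | rfl <;> norm_num)
    (by simp only [List.isChain_cons_cons, List.isChain_singleton, and_true, hev]; norm_num)
    (a := c₁ + c₁⁻¹) (b := c₂ + c₂⁻¹) (by rw [hc₁, hc₂]; norm_num)
    (Or.inr (by rw [hc₁]; norm_num)) (by rw [hev, hev, hc₁, hc₂]; norm_num)
  rw [traceLift_c18_04] at hM1 hMM
  have hc1y : 2 < c₁ + c₁⁻¹ := by rw [hc₁]; norm_num
  rw [abs_of_pos (by linarith)] at hMM
  have hMpos : 0 < intMahlerMeasure (ofCoeffs c18_04) := by linarith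
  constructor
  · have h : c₁ + c₁⁻¹ < intMahlerMeasure (ofCoeffs c18_04) + (intMahlerMeasure (ofCoeffs c18_04))⁻¹ := by
      rw [hMM]; linarith
    exact lt_of_add_inv_lt_add_inv hM1.le (by rw [hc₁]; norm_num) h
  · have h : intMahlerMeasure (ofCoeffs c18_04) + (intMahlerMeasure (ofCoeffs c18_04))⁻¹ < c₂ + c₂⁻¹ := by
      rw [hMM]; linarith
    exact lt_of_add_inv_lt_add_inv (by rw [hc₂]; norm_num) hMpos h

/-- `traceLift` of the trace polynomial of `c18_09` is the core `c18_09`. -/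
theorem traceLift_c18_09 : traceLift (X ^ 9 - C 9 * X ^ 7 + C 27 * X ^ 5 - C 31 * X ^ 3 - X ^ 2 + C 11 * X + 1 : ℤ[X]) = ofCoeffs c18_09 := by
  have hdeg : (X ^ 9 - C 9 * X ^ 7 + C 27 * X ^ 5 - C 31 * X ^ 3 - X ^ 2 + C 11 * X + 1 : ℤ[X]).natDegree = 9 := by compute_degree!
  have hP : ofCoeffs c18_09 = (X ^ 18 - X ^ 12 - X ^ 11 - X ^ 10 - X ^ 9 - X ^ 8 - X ^ 7 - X ^ 6 + 1 : ℤ[X]) := by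
    unfold ofCoeffs c18_09; simp [List.zipIdx]; ring
  rw [hP, traceLift, hdeg]
  simp only [Finset.sum_range_succ, Finset.sum_range_zero, zero_add, coeff_add, coeff_sub, coeff_X_pow,
    coeff_C_mul, coeff_X, coeff_one]
  norm_num
  ring

/-- **`1.25277593 < M(c18_09) < 1.25277594`** — a degree-18 Salem number (height-1 census core). -/
theorem c18_09_measure_enclosure :
    (125277593 / 10 ^ 8 : ℝ) < intMahlerMeasure (ofCoeffs c18_09) ∧
      intMahlerMeasure (ofCoeffs c18_09) < 125277594 / 10 ^ 8 := by
  set Q : ℤ[X] := X ^ 9 - C 9 * X ^ 7 + C 27 * X ^ 5 - C 31 * X ^ 3 - X ^ 2 + C 11 * X + 1 with hQdef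
  have hQmonic : Q.Monic := by rw [hQdef]; monicity!
  have hQdeg : Q.natDegree = 9 := by rw [hQdef]; compute_degree!
  have hev : ∀ y : ℝ, aeval y Q = y ^ 9 - 9 * y ^ 7 + 27 * y ^ 5 - 31 * y ^ 3 - y ^ 2 + 11 * y + 1 := by
    intro y
    rw [hQdef]
    simp only [map_add, map_sub, map_mul, map_pow, aeval_X, map_ofNat, map_one]
  set c₁ : ℝ := 125277593 / 10 ^ 8 with hc₁
  set c₂ : ℝ := 125277594 / 10 ^ 8 with hc₂
  obtain ⟨y, hya, hyb, hM1, hMM⟩ := salem_certificate_of_signs hQmonic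
    [-2, -7/4, -3/2, -1, -1/2, 0, 1, 3/2, 2] (by rw [hQdeg]; rfl)
    (by simp only [List.isChain_cons_cons, List.isChain_singleton, and_true]; norm_num)
    (by intro p hp; simp only [List.mem_cons, List.mem_nil_iff, or_false] at hp
        rcases hp with rfl | rfl | rfl | rfl | rfl | rfl | rfl | rfl | rfl <;> norm_num)
    (by simp only [List.isChain_cons_cons, List.isChain_singleton, and_true, hev]; norm_num)
    (a := c₁ + c₁⁻¹) (b := c₂ + c₂⁻¹) (by rw [hc₁, hc₂]; norm_num)
    (Or.inr (by rw [hc₁]; norm_num)) (by rw [hev, hev, hc₁, hc₂]; norm_num)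
  rw [traceLift_c18_09] at hM1 hMM
  have hc1y : 2 < c₁ + c₁⁻¹ := by rw [hc₁]; norm_num
  rw [abs_of_pos (by linarith)] at hMM
  have hMpos : 0 < intMahlerMeasure (ofCoeffs c18_09) := by linarith
  constructor
  · have h : c₁ + c₁⁻¹ < intMahlerMeasure (ofCoeffs c18_09) + (intMahlerMeasure (ofCoeffs c18_09))⁻¹ := by
      rw [hMM]; linarith
    exact lt_of_add_inv_lt_add_inv hM1.le (by rw [hc₁]; norm_num) h
  · have h : intMahlerMeasure (ofCoeffs c18_09) + (intMahlerMeasure (ofCoeffs c18_09))⁻¹ < c₂ + c₂⁻¹ := by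
      rw [hMM]; linarith
    exact lt_of_add_inv_lt_add_inv (by rw [hc₂]; norm_num) hMpos h

end Summit.Ventures.DiscreteObjects.Mahler
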